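import Summits.QuantumFields.BalabanUV.T4Continuum.Support.CTGaugeTerm
import Summits.QuantumFields.BalabanUV.T4Continuum.Support.CTAdmissibleRate
import Summits.QuantumFields.YangMills.Theorems.BalabanUVNodesN15CovariantLandauLetterRows
import Summits.QuantumFields.YangMills.Theorems.BalabanUVNodesN15TwoGridLandauReduction
import Summits.QuantumFields.YangMills.Theorems.BalabanUVNodesN15CovariantLandauFlat
import HarnessLib

/-!
# Route «BalabanUVNodes», node N15 = NE2, road (c) — PROGRAMME (P-S), XII: THE FOURTH FLAT ROW — `(Q′G′²Q′ᵀ)⁻¹(1) ≤ C_S·n^{d+1}·e^{−δ|y−y′|}` ON EVERY TORUS, PROVED BY THE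
# T⁴ CELL's COMBES–THOMAS KIT (`CTGaugeTerm.coercive_Kcomp`, `opNorm_conjMat_Kcomp_sub_le`, `CTWeightedCoercivity.WCoercive.pairing_decay_inv`) with the Lipschitz weight
# `x ↦ |x − x₀(y′)|_{T_η}` (dag-n15-c g23, n15-c∕222)

Cell `pub-ymgap`, seat `pub-ymgap-dag-n15-c` (generation g23; R134 (a), s1; HUMAN RULING D-0062; chair R424 venue).  `bears_on: R4∕N15 · K3⁸ SpineGivenEndpointR13SepCoPHV
(stmt-QuantumFields-27366)`; filed `--supports stmt-QuantumFields-27366 --as helper` — COUNT-NEUTRAL.  One bookkeeping `def` (`ctW`, the weight) + theorems; 0 `sorry`; HYPOTHESIS-FREE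
(any torus `M`, any `n ≥ 1`, any `a′ > 0`).  Imports BY NAME the T⁴ cell's `CTGaugeTerm` (`coercive_Kcomp`, `opNorm_conjMat_Kcomp_sub_le`), `CTWeightedCoercivity`
(`conjDefect_of_opNorm`, `wCoercive_of_coercive`, `WCoercive.pairing_decay_inv`), `CTAdmissibleRate` (`eventually_Jfree_lt`, `eventually_deltaK_lt`, `exists_pos_le_one_of_eventually`),
`ScalarGaugeProjectionUnit.Kone_eq`∕`isUnit_det_Kone`, n15-c∕200 (`sopFlat_eq_reM`, `isReal_Kone`; 197 `cSop_one`), n15-c∕213–214 (`BlockRows.hasMaj_mulVecLin_of_sum_abs_le`, `sum_fibre_blkC`),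
dag-n15-a (`TwoGrid.tdistT_blockOf_le_distU_add_one`, `distSite_eq_tdistT`), `King1986.Torus.tdistT_le_of_blockOf_eq`, `King1986.Torus.site_eq_bpt` (King's block map = B5's, inlined).  Nothing modified.

WHY.  After n15-c∕220–221 the only FLAT row of the Landau letter's primitive family still displayed is `S(1)⁻¹ = (Q′G′²Q′ᵀ)⁻¹(1)` ([Balaban1984PropagatorsII] Prop. 2.3 shape).  In the
tree `Q′G′²Q′ᵀ` at `a = a′n^{d+1}` IS `Re Kone = n^{−(d+1)}·Re Kcomp` (n15-c∕200 `sopFlat_eq_reM`, `Kone_eq`), and the T⁴ cell's Combes–Thomas kit PROVES, on every torus: `Kcomp` is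
`σ₀²`-coercive and its conjugation by `e^{κρ}` for a `1/n`-Lipschitz fine weight `ρ₀` with block oscillation `≤ Λ` moves it by `≤ deltaK(κ, Λ) → 0` (`κ → 0`); weighted coercivity then
gives the PAIRING DECAY `|⟨δ_y, Kcomp⁻¹δ_{y′}⟩| ≤ e^{−κR}/γ_w` whenever the weight is `≤ 0` at `y′` and `≥ R` at `y`.  THIS FILE supplies the weight `ctW y′ x = |x − x₀(y′)|_{T_η}/n`
(`x₀(y′)` the base point of the block `y′`): Lipschitz `1/n`, oscillation `≤ 1`, `= 0` at `y′`, `≥ |y − y′|_T − 1` at `y` — and reads the decay as the sharp-block row of `cSop(1)⁻¹ =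
n^{d+1}·Re Kcomp⁻¹ ⊗ 1_ι` with `C_S = e^{κ}·(σ₀² − deltaK)⁻¹`, rate `κ = κ(d, a′) > 0`.
* §1 `ctW`, `ctW_lip`, `ctW_osc`, `coarseW_ctW_self`, `coarseW_ctW_ge`; `wCoercive_smul`.
* §2 ★★ `norm_Kone_inv_apply_le` — `‖Kone⁻¹(y, y′)‖ ≤ n^{d+1}·e^{κ}(σ₀² − deltaK)⁻¹·e^{−κ|y−y′|_T}`.
* §3 ★★★ **`flatSopRow_ct`** — `∃ C_S δ > 0 ∀ n M k ι`: `HasMaj BC BC (mulVecLin (cSop M n 1 (a′n^{d+1}))⁻¹) (C_S·n^{d+1}·e^{−δ|y−y′|_T})`.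

HONEST FRAMING ∕ LIMITS.  Finite-dimensional Combes–Thomas argument of the T⁴ cell (its constants `σ₀`, `deltaK`, `Jfree`, `gammaPs` — OURS, not Bałaban's), read on the model's flat
objects at `U ≡ 1`; NOT [Balaban1984PropagatorsII] Prop. 2.3 as printed (no `L^p`, no multiscale `a_k`); NE2⁺ NOT PRINTED; N15 of record untouched (DISCHARGED AS CONSUMED, p687738); counts
UNMOVED (typed 28∕28 · discharged 8∕27); one finite 𝕋⁴ at fixed ε per index — NOT infinite volume ∕ OS ∕ mass gap ∕ Clay.  Restate-immune (no Theses import).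
-/

noncomputable section

open scoped BigOperators Matrix Kronecker ComplexConjugate
open Filter Topology

namespace Summit.QuantumFields.YangMills.BalabanUVNodes.N15.CovLandau

open Literature.MathematicalPhysics.QuantumFieldTheory.Balaban1983to89
open Literature.MathematicalPhysics.QuantumFieldTheory.Balaban1983to89.B5Prop11Plancherel (Tor fine unitVec)
open Literature.MathematicalPhysics.QuantumFieldTheory.Balaban1983to89.B5Prop11Lower (nsq nsq_nonneg)
open Literature.MathematicalPhysics.QuantumFieldTheory.Balaban1983to89.B5Block118 (bpt)
open Literature.MathematicalPhysics.QuantumFieldTheory.Balaban1983to89.B5RealFields (IsReal reM reM_apply)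
open Literature.MathematicalPhysics.QuantumFieldTheory.Balaban1983to89.B11SectG (BlockNorm HasMaj)
open Literature.MathematicalPhysics.QuantumFieldTheory.Balaban1983to89.B6UnitTorusCarrier (unitTorusGeo)
open Literature.MathematicalPhysics.QuantumFieldTheory.Balaban1983to89.T4EtaRateCoeffDefect (fibre mem_fibre)
open Literature.MathematicalPhysics.QuantumFieldTheory.King1986.Torus (blockOf blockEquiv blockEquiv_apply blockOf_site site_eq_bpt tdistT tdistT_nonneg tdistT_symm tdistT_self tdistT_triangle tdistT_add_unitVec_le tdistT_le_of_blockOf_eq)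
open Summit.QuantumFields.BalabanUV.T4Continuum.CoerciveInverseTower (Coercive)
open Summit.QuantumFields.BalabanUV.T4Continuum.ScalarAveragedPropagator (gammaPs)
open Summit.QuantumFields.BalabanUV.T4Continuum.ScalarAveragedCompression (Kcomp sigma0 sigma0_pos)
open Summit.QuantumFields.BalabanUV.T4Continuum.ScalarGaugeProjectionUnit (Kone Kone_eq isUnit_det_Kone)
open Summit.QuantumFields.BalabanUV.Beta.AccretiveCombesThomas (conjForm)
open Summit.QuantumFields.BalabanUV.T4Continuum.CTWeightedCoercivity (conjMat conjMat_smul conjForm_eq ConjDefect WCoercive conjDefect_of_opNorm wCoercive_of_coercive)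
open Summit.QuantumFields.BalabanUV.T4Continuum.CTConjugationTorus (coarseW)
open Summit.QuantumFields.BalabanUV.T4Continuum.CTScalarGreen (Jfree)
open Summit.QuantumFields.BalabanUV.T4Continuum.CTGaugeTerm (deltaK coercive_Kcomp opNorm_conjMat_Kcomp_sub_le)
open Summit.QuantumFields.BalabanUV.T4Continuum.CTAdmissibleRate (eventually_Jfree_lt eventually_deltaK_lt exists_pos_le_one_of_eventually)
open Summit.QuantumFields.YangMills.BalabanUVNodes.N15.MatrixSpecies (liftBlk)
open Summit.QuantumFields.YangMills.BalabanUVNodes.N15.BlockRows (hasMaj_mulVecLin_of_sum_abs_le)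
open Summit.QuantumFields.YangMills.BalabanUVNodes.N15.TwoGrid (tdistT_blockOf_le_distU_add_one distSite_eq_tdistT)

variable {d : ℕ}

/-! ## §1 The Combes–Thomas weight `|x − x₀(y′)|_{T_η}/n` and its four properties; scaling of weighted coercivity -/

section Weight

variable (M : Fin (d + 1) → ℕ) [∀ μ, NeZero (M μ)] (n : ℕ) [NeZero n]

/-- THE WEIGHT: `ctW y′ x = |x − x₀(y′)|_{T_η}/n`, `x₀(y′) = bpt n M y′ 0` the base point of the block `y′`. [cite: Balaban1984PropagatorsI, Lemma 2.2 p.41 (the conjugation weight: shape)] -/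
def ctW (y' : Tor M) (x : Tor (fine n M)) : ℝ := tdistT (fine n M) (bpt n M y' fun _ => 0) x / n

/-- `1/n`-Lipschitz along fine bonds. [folklore] -/
theorem ctW_lip (y' : Tor M) (x : Tor (fine n M)) (ν : Fin (d + 1)) : |ctW M n y' (x + unitVec (fine n M) ν) - ctW M n y' x| ≤ 1 / n := by
  have hn : (0 : ℝ) < n := Nat.cast_pos.mpr (Nat.pos_of_ne_zero (NeZero.ne n))
  rw [ctW, ctW, ← sub_div, abs_div, abs_of_pos hn, div_le_div_iff_of_pos_right hn, abs_le]
  have h1 := tdistT_triangle (fine n M) (bpt n M y' fun _ => 0) x (x + unitVec (fine n M) ν)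
  have h2 := tdistT_triangle (fine n M) (bpt n M y' fun _ => 0) (x + unitVec (fine n M) ν) x
  have h3 := tdistT_add_unitVec_le (fine n M) x ν
  have h4 : tdistT (fine n M) (x + unitVec (fine n M) ν) x ≤ 1 := by rw [tdistT_symm]; exact h3
  constructor <;> linarith

/-- block oscillation `≤ 1`. [folklore] -/
theorem ctW_osc (y' : Tor M) (x x' : Tor (fine n M)) (h : B5Blocks16.blockOf n M x = B5Blocks16.blockOf n M x') : |ctW M n y' x - ctW M n y' x'| ≤ 1 := by
  have hn : (0 : ℝ) < n := Nat.cast_pos.mpr (Nat.pos_of_ne_zero (NeZero.ne n))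
  have hKB : ∀ z : Tor (fine n M), blockOf n M z = B5Blocks16.blockOf n M z := fun z => by
    obtain ⟨⟨b, j⟩, rfl⟩ := (blockEquiv n M).surjective z
    rw [blockEquiv_apply, blockOf_site, site_eq_bpt, B5Blocks16.blockOf_bpt]
  have hK : blockOf n M x = blockOf n M x' := by rw [hKB, hKB, h]
  have hle := tdistT_le_of_blockOf_eq (N := n) (M := M) hK
  rw [ctW, ctW, ← sub_div, abs_div, abs_of_pos hn, div_le_iff₀ hn, one_mul, abs_le]
  have h1 := tdistT_triangle (fine n M) (bpt n M y' fun _ => 0) x x'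
  have h2 := tdistT_triangle (fine n M) (bpt n M y' fun _ => 0) x' x
  have h3 : tdistT (fine n M) x' x ≤ (n : ℝ) - 1 := by rw [tdistT_symm]; exact hle
  constructor <;> linarith

/-- the weight vanishes at the source block. [folklore] -/
theorem coarseW_ctW_self (y' : Tor M) : coarseW n M (ctW M n y') y' = 0 := by
  simp [coarseW, ctW, tdistT_self]

/-- the weight at the block `y` is `≥ |y − y′|_T − 1`. [folklore] -/
theorem coarseW_ctW_ge (y' y : Tor M) : tdistT M y y' - 1 ≤ coarseW n M (ctW M n y') y := by
  have hKB : ∀ z : Tor (fine n M), blockOf n M z = B5Blocks16.blockOf n M z := fun z => by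
    obtain ⟨⟨b, j⟩, rfl⟩ := (blockEquiv n M).surjective z
    rw [blockEquiv_apply, blockOf_site, site_eq_bpt, B5Blocks16.blockOf_bpt]
  have h1 := tdistT_blockOf_le_distU_add_one M n (bpt n M y fun _ => 0) (bpt n M y' fun _ => 0)
  rw [hKB, hKB, B5Blocks16.blockOf_bpt, B5Blocks16.blockOf_bpt,
    B5SiteBridgeP12.distU_eq_distSite_div, distSite_eq_tdistT, tdistT_symm] at h1
  show tdistT M y y' - 1 ≤ tdistT (fine n M) (bpt n M y' fun _ => 0) (bpt n M y fun _ => 0) / n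
  rw [tdistT_symm (fine n M), tdistT_symm M]
  linarith

end Weight

/-- Weighted coercivity scales: `WCoercive A κ ρ γ ⇒ WCoercive (r•A) κ ρ (rγ)` for real `r ≥ 0`. [folklore] -/
theorem wCoercive_smul {ι : Type} [Fintype ι] [DecidableEq ι] {A : Matrix ι ι ℂ} {κ : ℝ} {ρ : ι → ℝ} {γ : ℝ} (h : WCoercive A κ ρ γ) {r : ℝ} (hr : 0 ≤ r) :
    WCoercive (((r : ℝ) : ℂ) • A) κ ρ (r * γ) := by
  intro z
  have hz := h z
  rw [conjForm_eq] at hz ⊢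
  rw [conjMat_smul, Matrix.smul_mulVec, dotProduct_smul, smul_eq_mul, Complex.mul_re, Complex.ofReal_re, Complex.ofReal_im, zero_mul, sub_zero, mul_assoc]
  exact mul_le_mul_of_nonneg_left hz hr

/-! ## §2 The entries of `Kone⁻¹` decay -/

section Entries

variable (M : Fin (d + 1) → ℕ) [∀ μ, NeZero (M μ)] (n : ℕ) [NeZero n]

/-- `nsq δ_y = 1`. [folklore] -/
theorem nsq_single_one (y : Tor M) : nsq (Pi.single y (1 : ℂ)) = 1 := by
  classical
  simp [nsq, Pi.single_apply, Finset.sum_ite_eq', apply_ite]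

/-- `⟨δ_y, w⟩ = w y`. [folklore] -/
theorem star_single_dotProduct (y : Tor M) (w : Tor M → ℂ) : star (Pi.single y (1 : ℂ)) ⬝ᵥ w = w y := by
  classical
  simp [dotProduct, Pi.single_apply, apply_ite]

/-- `(Aδ_{y′})(z) = A z y′`. [folklore] -/
theorem mulVec_single_one (A : Matrix (Tor M) (Tor M) ℂ) (y' z : Tor M) : (A *ᵥ Pi.single y' (1 : ℂ)) z = A z y' := by
  classical
  simp [Matrix.mulVec, dotProduct, Pi.single_apply]

/-- ★★ **THE ENTRIES OF `Kone⁻¹ = (Q′G′²Q′ᴴ)⁻¹` DECAY**: for the T⁴ cell's admissible `κ` (with `Jfree < γ′`, `deltaK < σ₀²` at oscillation `Λ = 1`),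
`‖Kone⁻¹(y, y′)‖ ≤ n^{d+1}·(σ₀² − deltaK)⁻¹·e^{κ}·e^{−κ|y − y′|_T}`. [cite: Balaban1984PropagatorsII, Prop. 2.3 p.231 (shape); Balaban1984PropagatorsI, Lemma 2.2 p.41 (method)] -/
theorem norm_Kone_inv_apply_le {a' : ℝ} (ha' : 0 < a') {κ : ℝ} (hκ : 0 ≤ κ) (hJ : Jfree (d + 1) a' κ 1 < gammaPs (d + 1) a') (hδ : deltaK (d + 1) a' κ 1 < sigma0 (d + 1) a' ^ 2)
    (y y' : Tor M) :
    ‖(Kone n M a')⁻¹ y y'‖ ≤ ((n : ℝ) ^ (d + 1) * (sigma0 (d + 1) a' ^ 2 - deltaK (d + 1) a' κ 1)⁻¹ * Real.exp κ) * Real.exp (-(κ * tdistT M y y')) := by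
  classical
  -- weighted coercivity of `Kcomp`, then of `Kone = n^{−(d+1)}·Kcomp`
  have hdef := opNorm_conjMat_Kcomp_sub_le n M ha' zero_le_one (ρ₀ := ctW M n y') (κ := κ) (fun x ν => ctW_lip M n y' x ν) (fun x x' h => ctW_osc M n y' x x' h) hJ
  have hW := wCoercive_of_coercive (coercive_Kcomp n M ha') (conjDefect_of_opNorm hdef)
  have hnpos : (0 : ℝ) < (n : ℝ) ^ (d + 1) := pow_pos (Nat.cast_pos.mpr (Nat.pos_of_ne_zero (NeZero.ne n))) _
  have hr : (0 : ℝ) ≤ ((n : ℝ) ^ (d + 1))⁻¹ := inv_nonneg.mpr hnpos.le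
  have hW1 := wCoercive_smul hW hr
  have hKone : ((((((n : ℝ) ^ (d + 1))⁻¹ : ℝ)) : ℂ) • Kcomp n M a') = Kone n M a' := by
    rw [Kone_eq]; push_cast; rfl
  rw [hKone] at hW1
  have hγ : 0 < ((n : ℝ) ^ (d + 1))⁻¹ * (sigma0 (d + 1) a' ^ 2 - deltaK (d + 1) a' κ 1) := mul_pos (inv_pos.mpr hnpos) (by linarith)
  -- pairing decay between `δ_y` and `δ_{y′}`
  have hpair := hW1.pairing_decay_inv hγ hκ (v := Pi.single y' (1 : ℂ)) (u := Pi.single y (1 : ℂ)) (R := tdistT M y y' - 1)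
    (fun e he => by
      have : e = y := by by_contra hne; exact he (by simp [hne])
      rw [this]; exact coarseW_ctW_ge M n y' y)
    (fun e he => by
      have : e = y' := by by_contra hne; exact he (by simp [hne])
      rw [this, coarseW_ctW_self])
  rw [star_single_dotProduct, mulVec_single_one, nsq_single_one, nsq_single_one, Real.sqrt_one, mul_one, mul_one] at hpair
  refine hpair.trans (le_of_eq ?_)
  rw [div_eq_mul_inv, mul_inv, inv_inv, show -(κ * (tdistT M y y' - 1)) = κ + -(κ * tdistT M y y') by ring, Real.exp_add]
  ring

end Entries

/-! ## §3 The flat row of `S(1)⁻¹` -/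

section Row

variable (L : ℕ)

/-- ★★★ **THE FOURTH FLAT ROW, PROVED ON EVERY TORUS**: for `a′ > 0` there are `C_S, δ > 0` (depending on `d, a′` only) with
`HasMaj BC BC (mulVecLin (cSop M n 1 (a′n^{d+1}))⁻¹) (C_S·n^{d+1}·e^{−δ|y−y′|_T})` for every torus `M`, every `n ≥ 1`, every geometry label `k` and colour type `ι`.
[cite: Balaban1984PropagatorsII, Prop. 2.3 p.231 (shape); Balaban1984PropagatorsI, Lemma 2.2 p.41 (Combes–Thomas method)] -/
theorem flatSopRow_ct {a' : ℝ} (ha' : 0 < a') :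
    ∃ CS δ : ℝ, 0 < CS ∧ 0 < δ ∧ ∀ (M : Fin (d + 1) → ℕ) [∀ μ, NeZero (M μ)] (n : ℕ) [NeZero n] (k : ℕ) (ι : Type) [Fintype ι] [DecidableEq ι],
      HasMaj (BlockNorm.ofBlocks (unitTorusGeo L k M) (liftBlk (fun y : Tor M => y) ι)) (BlockNorm.ofBlocks (unitTorusGeo L k M) (liftBlk (fun y : Tor M => y) ι))
        (Matrix.mulVecLin (cSop M n (fun (_ : Fin (d + 1)) (_ : Tor (fine n M)) => (1 : Matrix ι ι ℝ)) (a' * (n : ℝ) ^ (d + 1)))⁻¹)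
        (fun y y' => CS * (n : ℝ) ^ (d + 1) * Real.exp (-(δ * tdistT M y y'))) := by
  classical
  obtain ⟨κ, hκ0, -, hJ, hδ⟩ := exists_pos_le_one_of_eventually ((eventually_Jfree_lt (d + 1) a' 1).and (eventually_deltaK_lt (d + 1) ha' 1))
  have hgap : 0 < sigma0 (d + 1) a' ^ 2 - deltaK (d + 1) a' κ 1 := by linarith
  refine ⟨(sigma0 (d + 1) a' ^ 2 - deltaK (d + 1) a' κ 1)⁻¹ * Real.exp κ, κ, by positivity, hκ0, ?_⟩
  intro M _ n _ k ι _ _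
  have hnpos : (0 : ℝ) < (n : ℝ) ^ (d + 1) := pow_pos (Nat.cast_pos.mpr (Nat.pos_of_ne_zero (NeZero.ne n))) _
  -- `cSop(1)⁻¹ = Re Kone⁻¹ ⊗ 1`
  have hK := (isReal_Kone M n a').2.2
  have hKinv : Kone n M a' * (Kone n M a')⁻¹ = 1 := Matrix.mul_nonsing_inv _ (isUnit_det_Kone n M ha')
  have hdetR : IsUnit (reM (Kone n M a')).det :=
    Matrix.isUnit_det_of_right_inverse (B := reM ((Kone n M a')⁻¹)) (by rw [← hK.reM_mul hK.inv, hKinv, B5RealFields.reM_one])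
  have hinv : (cSop M n (fun (_ : Fin (d + 1)) (_ : Tor (fine n M)) => (1 : Matrix ι ι ℝ)) (a' * (n : ℝ) ^ (d + 1)))⁻¹ = reM ((Kone n M a')⁻¹) ⊗ₖ (1 : Matrix ι ι ℝ) := by
    rw [cSop_one, sopFlat_eq_reM M n ha', ← hK.reM_inv hKinv]
    refine Matrix.inv_eq_left_inv ?_
    rw [← Matrix.mul_kronecker_mul, Matrix.nonsing_inv_mul _ hdetR, Matrix.one_mul, Matrix.one_kronecker_one]
  rw [hinv]
  refine hasMaj_mulVecLin_of_sum_abs_le (g := unitTorusGeo L k M) (liftBlk (fun y : Tor M => y) ι) (liftBlk (fun y : Tor M => y) ι) (fun y y' => by positivity) fun p w => ?_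
  rw [sum_fibre_blkC]
  have hent : ∀ j : ι, |(reM ((Kone n M a')⁻¹) ⊗ₖ (1 : Matrix ι ι ℝ)) p (w, j)| = |((Kone n M a')⁻¹ p.1 w).re| * (if p.2 = j then 1 else 0) := by
    intro j
    rw [Matrix.kroneckerMap_apply, reM_apply, Matrix.one_apply, abs_mul]
    split_ifs <;> simp
  simp_rw [hent]
  rw [← Finset.mul_sum, Finset.sum_ite_eq Finset.univ p.2, if_pos (Finset.mem_univ _), mul_one]
  refine (Complex.abs_re_le_norm _).trans ((norm_Kone_inv_apply_le M n ha' hκ0.le hJ hδ p.1 w).trans (le_of_eq ?_))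
  show _ = (sigma0 (d + 1) a' ^ 2 - deltaK (d + 1) a' κ 1)⁻¹ * Real.exp κ * (n : ℝ) ^ (d + 1) * Real.exp (-(κ * tdistT M (liftBlk (fun y : Tor M => y) ι p) w))
  rw [show liftBlk (fun y : Tor M => y) ι p = p.1 from rfl]
  ring

end Row

end Summit.QuantumFields.YangMills.BalabanUVNodes.N15.CovLandau

end
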